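/-
Copyright (c) 2026. All rights reserved.
Released under Apache 2.0 license as described in the file LICENSE.
-/
import Mathlib
import Summits.MatrixMultiplication.MatrixMultiplication.Theorems.SubgroupIdentityDesigns.Negative.TwoPointActions
import Summits.MatrixMultiplication.MatrixMultiplication.Theorems.SubgroupIdentityDesigns.Negative.TwoPointOrders

/-!
# Two-point actions, sharp form: the exceptional branch has index `12`, `24` or `60` exactly,
# with bounded element orders

`TwoPointActions.two_point_action` classifies finite group actions in which every element outside
the kernel `K` has exactly two fixed points: `K = Γ`, or an invariant fix-or-swap pair, or
`|Γ| ≤ 60 |K|`.  This file sharpens the third branch to what the orbit count really gives: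
`|Γ| = N |K|` with `N ∈ {12, 24, 60}` and, for every `γ ∈ Γ`, `γ² ∈ K` or `γ³ ∈ K` or
(`γ⁴ ∈ K` and `N = 24`) or (`γ⁵ ∈ K` and `N = 60`) — i.e. the element orders of `Γ/K` divide the
stabiliser indices `(2,3,3)`, `(2,3,4)`, `(2,3,5)` of the three orbits (every non-kernel element
lies in the stabiliser of one of its two fixed points, whose image in `Γ/K` has order `e`).

This is the input for the parity law of exceptional members of `GL₂(𝔽_p)` (an exceptional
`p`-free subgroup contains `-1`), used by the small-prime order sieve of the `(2,1)` cell.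

VALUE = THEOREM (abstract group actions), NOT summit progress; the crux item is untouched.
Report: `run/shared/lean/b2b/levelgraded-cu/ORACLE-g17.md`.
-/

set_option linter.dupNamespace false

noncomputable section

open scoped Classical
open MulAction

namespace Summit.MatrixMultiplication.MatrixMultiplication.Theorems.SubgroupIdentityDesigns.Negative

section TwoPointActionsSharp

variable {Γ X : Type*} [Group Γ] [MulAction Γ X]

/-! ### The sharp orbit count -/

/-- **Two-point actions, sharp form.**  If every element outside the kernel `K` has exactly two
fixed points, then `K = Γ`, or some pair `Fix(γ₀)` is fixed-or-swapped by all of `Γ`, or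
`|Γ| = |K| · N` with `N ∈ {12, 24, 60}` and every `γ ∈ Γ` has `γ² ∈ K` or `γ³ ∈ K` or
(`γ⁴ ∈ K`, `N = 24`) or (`γ⁵ ∈ K`, `N = 60`). -/
theorem two_point_action_sharp [Fintype Γ]
    (h2 : ∀ γ : Γ, γ ∉ actKer Γ X → ∃ x y : X, x ≠ y ∧ fixedBy X γ = {x, y}) :
    actKer Γ X = ⊤ ∨
    (∃ x y : X, x ≠ y ∧ (∃ γ₀ : Γ, γ₀ ∉ actKer Γ X ∧ fixedBy X γ₀ = {x, y}) ∧
        ∀ γ : Γ, (γ • x = x ∧ γ • y = y) ∨ (γ • x = y ∧ γ • y = x)) ∨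
    (∃ N : ℕ, (N = 12 ∨ N = 24 ∨ N = 60) ∧ Nat.card Γ = Nat.card (actKer Γ X) * N ∧
      ∀ γ : Γ, γ ^ 2 ∈ actKer Γ X ∨ γ ^ 3 ∈ actKer Γ X ∨
        (γ ^ 4 ∈ actKer Γ X ∧ N = 24) ∨ (γ ^ 5 ∈ actKer Γ X ∧ N = 60)) := by
  set K := actKer Γ X with hKdef
  by_cases hKtop : K = ⊤
  · exact Or.inl hKtop
  right
  -- the invariant finite set `Y`
  set Y : Set X := {x | ∃ γ : Γ, γ ∉ K ∧ γ • x = x} with hYdef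
  have hYfin : Y.Finite := by
    have : Y ⊆ ⋃ γ : Γ, (if γ ∈ K then (∅ : Set X) else fixedBy X γ) := by
      rintro x ⟨γ, hγ, hx⟩
      simp only [Set.mem_iUnion]
      exact ⟨γ, by rw [if_neg hγ]; exact hx⟩
    refine Set.Finite.subset (Set.finite_iUnion fun γ => ?_) this
    split_ifs with h
    · exact Set.finite_empty
    · obtain ⟨x, y, -, hF⟩ := h2 γ h
      rw [hF]; exact (Set.finite_singleton y).insert x
  have hYinv : ∀ (γ : Γ) {x : X}, x ∈ Y → γ • x ∈ Y := by
    rintro γ x ⟨δ, hδ, hx⟩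
    exact ⟨γ * δ * γ⁻¹, conj_not_mem_actKer hδ, by rw [mul_smul, mul_smul, inv_smul_smul, hx]⟩
  let S : SubMulAction Γ X := ⟨Y, fun γ _ hx => hYinv γ hx⟩
  haveI : Fintype S := hYfin.fintype
  have hSval : ∀ (γ : Γ) (s : S), ((γ • s : S) : X) = γ • (s : X) := fun γ s => rfl
  -- kernel elements fix `S` pointwise; stabilisers contain `K`
  have hKfix : ∀ γ ∈ K, ∀ s : S, γ • s = s := by
    intro γ hγ s
    apply Subtype.ext
    rw [hSval]; exact (mem_actKer.mp hγ) _
  -- Burnside on `S`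
  have hB := MulAction.sum_card_fixedBy_eq_card_orbits_mul_card_group Γ S
  simp only [← Nat.card_eq_fintype_card] at hB
  set r := Nat.card (Quotient (orbitRel Γ S)) with hrdef
  have hfix_in : ∀ γ ∈ K, Nat.card (fixedBy S γ) = Nat.card S := by
    intro γ hγ
    have : fixedBy S γ = Set.univ := by
      ext s; simp only [MulAction.mem_fixedBy, Set.mem_univ, iff_true]; exact hKfix γ hγ s
    rw [this, Nat.card_congr (Equiv.Set.univ S)]
  have hfix_out : ∀ γ, γ ∉ K → Nat.card (fixedBy S γ) = 2 := by
    intro γ hγ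
    obtain ⟨x, y, hxy, hF⟩ := h2 γ hγ
    have hx : x ∈ fixedBy X γ := by rw [hF]; exact Set.mem_insert _ _
    have hy : y ∈ fixedBy X γ := by rw [hF]; exact Set.mem_insert_of_mem _ rfl
    have hxY : x ∈ Y := ⟨γ, hγ, hx⟩
    have hyY : y ∈ Y := ⟨γ, hγ, hy⟩
    have hxS : (⟨x, hxY⟩ : S) ∈ fixedBy S γ := Subtype.ext hx
    have hyS : (⟨y, hyY⟩ : S) ∈ fixedBy S γ := Subtype.ext hy
    rw [Nat.card_eq_two_iff]
    refine ⟨⟨_, hxS⟩, ⟨_, hyS⟩, ?_, ?_⟩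
    · intro h
      apply hxy
      have := congrArg (fun a : fixedBy S γ => ((a : S) : X)) h
      exact this
    · rw [Set.eq_univ_iff_forall]
      intro a
      have ha : ((a : S) : X) ∈ fixedBy X γ := by
        have := a.2
        rw [MulAction.mem_fixedBy] at this
        have := congrArg (fun s : S => (s : X)) this
        simpa [hSval] using this
      rw [hF] at ha
      simp only [Set.mem_insert_iff, Set.mem_singleton_iff] at ha ⊢
      rcases ha with ha | ha
      · left; exact Subtype.ext (Subtype.ext ha)
      · right; exact Subtype.ext (Subtype.ext ha)
  -- evaluate the Burnside sum
  set k := Nat.card K with hkdef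
  set n := Nat.card Γ with hndef
  set c := (Finset.univ.filter fun γ : Γ => γ ∉ K).card with hcdef
  have hkc : k + c = n := by
    have hk' : k = (Finset.univ.filter fun γ : Γ => γ ∈ K).card := by
      rw [hkdef, Nat.card_eq_fintype_card, Fintype.card_subtype]
    rw [hk', hcdef, Finset.card_filter_add_card_filter_not, Finset.card_univ, hndef,
      Nat.card_eq_fintype_card]
  have hsum : ∑ γ : Γ, Nat.card (fixedBy S γ) = Nat.card S * k + 2 * c := by
    have : ∀ γ : Γ, Nat.card (fixedBy S γ) = if γ ∈ K then Nat.card S else 2 := by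
      intro γ; split_ifs with h
      · exact hfix_in γ h
      · exact hfix_out γ h
    simp_rw [this]
    rw [Finset.sum_ite, Finset.sum_const, Finset.sum_const, smul_eq_mul, smul_eq_mul]
    have hk' : (Finset.univ.filter fun γ : Γ => γ ∈ K).card = k := by
      rw [hkdef, Nat.card_eq_fintype_card, Fintype.card_subtype]
    rw [hk', ← hcdef]; ring
  rw [hsum] at hB
  -- `n = k * N`
  have hkpos : 0 < k := Nat.card_pos
  obtain ⟨N, hN⟩ : k ∣ n := Subgroup.card_subgroup_dvd_card K
  have hN2 : 2 ≤ N := by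
    by_contra hlt
    push Not at hlt
    apply hKtop
    apply Subgroup.eq_top_of_le_card
    rw [← hndef, ← hkdef, hN]
    interval_cases N <;> omega
  -- orbit decomposition of `S`
  have hO : Nat.card S = ∑ ω : Quotient (orbitRel Γ S), Nat.card (orbit Γ ω.out) := by
    rw [Nat.card_eq_fintype_card, Fintype.card_congr (MulAction.selfEquivSigmaOrbits Γ S),
      Fintype.card_sigma]
    simp only [← Nat.card_eq_fintype_card]
  -- orbit–stabiliser for every point of `S`
  have hos : ∀ s : S, Nat.card (orbit Γ s) * Nat.card (stabilizer Γ s) = n := by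
    intro s
    rw [hndef, Nat.card_eq_fintype_card, Nat.card_eq_fintype_card, Nat.card_eq_fintype_card]
    exact MulAction.card_orbit_mul_card_stabilizer_eq_card_group Γ s
  have hKle : ∀ s : S, K ≤ stabilizer Γ s := fun s γ hγ => hKfix γ hγ s
  -- per-orbit data
  have horb : ∀ ω : Quotient (orbitRel Γ S),
      ∃ e : ℕ, 2 ≤ e ∧ Nat.card (orbit Γ ω.out) * e = N := by
    intro ω
    set s : S := ω.out with hsdef
    obtain ⟨e, he⟩ : k ∣ Nat.card (stabilizer Γ s) := Subgroup.card_dvd_of_le (hKle s)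
    -- `e ≠ 1`: some non-kernel element fixes `s`
    have he1 : e ≠ 1 := by
      intro h1
      rw [h1, mul_one] at he
      have hKeq : K = stabilizer Γ s := Subgroup.eq_of_le_of_card_ge (hKle s) (by rw [he])
      obtain ⟨δ, hδ, hδs⟩ := s.2
      apply hδ
      rw [hKeq, MulAction.mem_stabilizer_iff]
      exact Subtype.ext hδs
    have he0 : e ≠ 0 := by
      intro h0; rw [h0, mul_zero] at he
      exact (Nat.card_pos (α := stabilizer Γ s)).ne' he
    refine ⟨e, by omega, ?_⟩
    have hos' := hos s
    rw [he, hN] at hos'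
    have : k * (Nat.card (orbit Γ s) * e) = k * N := by rw [← hos']; ring
    exact Nat.eq_of_mul_eq_mul_left hkpos this
  choose e he2 hme using horb
  -- the stabiliser of ANY point of the orbit `ω` has order `k * e ω`
  have hstab : ∀ s : S, Nat.card (stabilizer Γ s) = k * e (Quotient.mk (orbitRel Γ S) s) := by
    intro s
    set ω := Quotient.mk (orbitRel Γ S) s with hωdef
    have hso : orbit Γ s = orbit Γ ω.out := by
      rw [MulAction.orbit_eq_iff]
      have : @Quotient.mk _ (orbitRel Γ S) ω.out = ω := Quotient.out_eq ω
      rw [hωdef] at this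
      exact Quotient.exact this.symm
    have h1 := hos s
    rw [hso, hN] at h1
    have h2' := hme ω
    have hm1 : 1 ≤ Nat.card (orbit Γ ω.out) := by
      by_contra h; push Not at h
      have h0 : Nat.card (orbit Γ ω.out) = 0 := by omega
      rw [h0, zero_mul] at h2'; omega
    -- `m * |Stab| = k * N = k * (m * e)`
    have : Nat.card (orbit Γ ω.out) * Nat.card (stabilizer Γ s) =
        Nat.card (orbit Γ ω.out) * (k * e ω) := by rw [h1, ← h2']; ring
    exact Nat.eq_of_mul_eq_mul_left (by omega) this
  -- hence `γ ^ e ω ∈ K` for every `γ` fixing a point of the orbit `ω`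
  have hpow : ∀ (s : S) (γ : Γ), γ • (s : X) = s →
      γ ^ e (Quotient.mk (orbitRel Γ S) s) ∈ K := by
    intro s γ hγs
    have hγS : γ ∈ stabilizer Γ s := by
      rw [MulAction.mem_stabilizer_iff]; exact Subtype.ext hγs
    haveI : K.Normal := by rw [hKdef]; unfold actKer; infer_instance
    exact pow_mem_of_card_eq (hKle s) (hstab s) hγS
  -- the two counting identities
  have hI : Nat.card S + 2 * N = r * N + 2 := by
    have h1 : Nat.card S * k + 2 * c = r * n := hB
    rw [hN] at h1 hkc
    have : k * (Nat.card S + 2 * N) = k * (r * N + 2) := by nlinarith [h1, hkc]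
    exact Nat.eq_of_mul_eq_mul_left hkpos this
  have hm1 : ∀ ω : Quotient (orbitRel Γ S), 1 ≤ Nat.card (orbit Γ ω.out) := by
    intro ω
    have := hme ω
    by_contra h; push Not at h
    have h0 : Nat.card (orbit Γ ω.out) = 0 := by omega
    rw [h0, zero_mul] at this; omega
  have hm2 : ∀ ω : Quotient (orbitRel Γ S), 2 * Nat.card (orbit Γ ω.out) ≤ N := by
    intro ω; have := hme ω; have := he2 ω; nlinarith
  have hcardΩ : (Finset.univ : Finset (Quotient (orbitRel Γ S))).card = r := by
    rw [Finset.card_univ, hrdef, Nat.card_eq_fintype_card]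
  have hr_le : r ≤ Nat.card S := by
    have := Finset.card_nsmul_le_sum (Finset.univ : Finset (Quotient (orbitRel Γ S)))
      (fun ω => Nat.card (orbit Γ ω.out)) 1 (fun ω _ => hm1 ω)
    rw [hcardΩ, smul_eq_mul, mul_one] at this
    rw [hO]; exact this
  have hr_ge : 2 * Nat.card S ≤ r * N := by
    have := Finset.sum_le_card_nsmul (Finset.univ : Finset (Quotient (orbitRel Γ S)))
      (fun ω => 2 * Nat.card (orbit Γ ω.out)) N (fun ω _ => hm2 ω)
    rw [hcardΩ, smul_eq_mul] at this
    rw [hO, Finset.mul_sum]; exact this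
  have hr3 : r ≤ 3 := by nlinarith
  have hr2 : 2 ≤ r := by nlinarith
  -- an orbit of size two in `S` is an invariant pair
  have horb2 : ∀ s₀ : S, Nat.card (orbit Γ s₀) = 2 →
      ∃ x y : X, x ≠ y ∧ (∃ γ₀ : Γ, γ₀ ∉ actKer Γ X ∧ fixedBy X γ₀ = {x, y}) ∧
        ∀ γ : Γ, (γ • x = x ∧ γ • y = y) ∨ (γ • x = y ∧ γ • y = x) := by
    intro s₀ h
    obtain ⟨a, b, hab, huniv2⟩ := Nat.card_eq_two_iff.mp h
    have hab' : ((a : S) : X) ≠ ((b : S) : X) := by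
      intro hh; apply hab; apply Subtype.ext; apply Subtype.ext; exact hh
    have hax : ∀ γ : Γ, ∀ t : orbit Γ s₀,
        ((γ • (t : S) : S) : X) = (a : S) ∨ ((γ • (t : S) : S) : X) = (b : S) := by
      intro γ t
      have hmem : γ • (t : S) ∈ orbit Γ s₀ := by
        obtain ⟨δ, hδ⟩ := MulAction.mem_orbit_iff.mp t.2
        exact MulAction.mem_orbit_iff.mpr ⟨γ * δ, by rw [mul_smul, hδ]⟩
      have : (⟨γ • (t : S), hmem⟩ : orbit Γ s₀) ∈ ({a, b} : Set (orbit Γ s₀)) := by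
        rw [huniv2]; exact Set.mem_univ _
      simp only [Set.mem_insert_iff, Set.mem_singleton_iff] at this
      rcases this with hh | hh
      · left; have := congrArg (fun u : orbit Γ s₀ => ((u : S) : X)) hh; exact this
      · right; have := congrArg (fun u : orbit Γ s₀ => ((u : S) : X)) hh; exact this
    obtain ⟨γ₀, hγ₀, hγ₀a⟩ := (a : S).2
    have hinv : ∀ γ : Γ, (γ • ((a : S) : X) = (a : S) ∨ γ • ((a : S) : X) = (b : S)) ∧
        (γ • ((b : S) : X) = (a : S) ∨ γ • ((b : S) : X) = (b : S)) :=
      fun γ => ⟨by rw [← hSval]; exact hax γ a, by rw [← hSval]; exact hax γ b⟩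
    obtain ⟨hF, hall⟩ := pair_of_invariant_pair h2 hab' hinv hγ₀ hγ₀a
    exact ⟨_, _, hab', ⟨γ₀, hγ₀, hF⟩, hall⟩
  -- case `r = 2`: `Y` itself is an invariant pair
  rcases Nat.lt_or_ge r 3 with hr | hr
  · have hr' : r = 2 := by omega
    have hS2 : Nat.card S = 2 := by rw [hr'] at hI; omega
    obtain ⟨a, b, hab, huniv⟩ := Nat.card_eq_two_iff.mp hS2
    left
    have hax : ∀ γ : Γ, ∀ s : S, ((γ • s : S) : X) = a ∨ ((γ • s : S) : X) = b := by
      intro γ s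
      have : γ • s ∈ ({a, b} : Set S) := by rw [huniv]; exact Set.mem_univ _
      simp only [Set.mem_insert_iff, Set.mem_singleton_iff] at this
      rcases this with h | h
      · left; rw [h]
      · right; rw [h]
    have hab' : (a : X) ≠ b := fun h => hab (Subtype.ext h)
    obtain ⟨γ₀, hγ₀, hγ₀a⟩ := a.2
    have hinv : ∀ γ : Γ, (γ • (a : X) = a ∨ γ • (a : X) = b) ∧
        (γ • (b : X) = a ∨ γ • (b : X) = b) :=
      fun γ => ⟨by rw [← hSval]; exact hax γ a, by rw [← hSval]; exact hax γ b⟩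
    obtain ⟨hF, hall⟩ := pair_of_invariant_pair h2 hab' hinv hγ₀ hγ₀a
    exact ⟨a, b, hab', ⟨γ₀, hγ₀, hF⟩, hall⟩
  -- case `r = 3`
  have hr' : r = 3 := by omega
  have hS3 : Nat.card S = N + 2 := by rw [hr'] at hI; omega
  have hcard3 : (Finset.univ : Finset (Quotient (orbitRel Γ S))).card = 3 := by
    rw [hcardΩ]; exact hr'
  obtain ⟨ω₁, ω₂, ω₃, h12, h13, h23, huniv⟩ := Finset.card_eq_three.mp hcard3
  have hsum3 : Nat.card (orbit Γ ω₁.out) + Nat.card (orbit Γ ω₂.out) +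
      Nat.card (orbit Γ ω₃.out) = N + 2 := by
    rw [← hS3, hO, huniv, Finset.sum_insert (by simp [h12, h13]),
      Finset.sum_insert (by simp [h23]), Finset.sum_singleton]
    ring
  rcases arith3_sharp (hme ω₁) (hme ω₂) (hme ω₃) (he2 ω₁) (he2 ω₂) (he2 ω₃) hsum3 with
    h | h | h | ⟨hNval, hE₁, hE₂, hE₃⟩
  · left; exact horb2 _ h
  · left; exact horb2 _ h
  · left; exact horb2 _ h
  right
  refine ⟨N, hNval, hN, fun γ => ?_⟩
  by_cases hγK : γ ∈ K
  · exact Or.inl (K.pow_mem hγK 2)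
  -- `γ` fixes a point `x ∈ Y`; its orbit is one of the three
  obtain ⟨x, y, -, hF⟩ := h2 γ hγK
  have hx : γ • x = x := by
    have : x ∈ fixedBy X γ := by rw [hF]; exact Set.mem_insert _ _
    exact this
  have hxY : x ∈ Y := ⟨γ, hγK, hx⟩
  set s : S := ⟨x, hxY⟩ with hsdef
  have hγe := hpow s γ hx
  set ω := Quotient.mk (orbitRel Γ S) s with hωdef
  have hω : ω ∈ ({ω₁, ω₂, ω₃} : Finset _) := by rw [← huniv]; exact Finset.mem_univ _
  simp only [Finset.mem_insert, Finset.mem_singleton] at hω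
  -- transport the admissibility of `e ωᵢ` to `e ω`
  have hE : e ω = 2 ∨ e ω = 3 ∨ (e ω = 4 ∧ N = 24) ∨ (e ω = 5 ∧ N = 60) := by
    rcases hω with h | h | h <;> rw [h]
    · exact hE₁
    · exact hE₂
    · exact hE₃
  rcases hE with h | h | ⟨h, h24⟩ | ⟨h, h60⟩
  · exact Or.inl (by rw [← h]; exact hγe)
  · exact Or.inr (Or.inl (by rw [← h]; exact hγe))
  · exact Or.inr (Or.inr (Or.inl ⟨by rw [← h]; exact hγe, h24⟩))
  · exact Or.inr (Or.inr (Or.inr ⟨by rw [← h]; exact hγe, h60⟩))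

end TwoPointActionsSharp

end Summit.MatrixMultiplication.MatrixMultiplication.Theorems.SubgroupIdentityDesigns.Negative

end
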